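import Summits.QuantumFields.YangMills.Theorems.BalabanUVNodesN18CombStepRemainderShift
import Summits.QuantumFields.YangMills.Theorems.BalabanUVNodesN18CombStepRemainderTransportPrelim
import HarnessLib

/-!
# BalabanUVNodes ∕ node N18 = NE5 — closure-ledger item (iii), comb step M4c, file (6c-β):
# THE TRANSPORTED LINEARISATION REMAINDER AT THE NEXT COARSE BOND MINUS THE ONE AT `c` IS `O(η_j)` (raw letters, pair-box axial gauge)

(Track A, DAG node N18 = `T4OutputRate.NE5`; cluster K4 «SpineRates», key item K3⁸ `SpineGivenEndpointR13SepCoPHV` (stmt-QuantumFields-27366);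
seat pub-ymgap-dag-n18-w3 g5, INTENT-6 = design step M4c of `COMB-STEP-DESIGN.md` ∕ `COMB-CHAIN-INDEX.md`.)

HONEST FRAMING.  Count-neutral kernel bookkeeping (`--supports stmt-QuantumFields-27366 --as helper`).  The C¹ cancelled sum (4d)
`norm_nabla_transported_comb_le` bounds the transported difference of the linearisation remainder
`Rem₁(c) = (iξ)⁻¹log(Ū(𝐔)(c)Ū(U)(c)⁻¹) − (η∕ξ)Q₁(Ad(axialT U (emb c₋))A′)(c)` between `c = ⟨y, μ⟩` and `c′ = ⟨y + e_ν, μ⟩` crudely by `2·R∕ξ`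
(the C¹ side term `2R∕ξ²` of FILE 7 without `η_j`-decay).  THIS file proves the coarse-Lipschitz replacement, in the raw letters of (4d):
`‖Ū(U)(y,ν)·Rem₁(c′)·Ū(U)(y,ν)⁻¹ − Rem₁(c)‖ ≤ 4·(17ℓt)·(R∕ξ + (η∕ξ)3ℓ²ta) + (η∕ξ)3ℓ²ta + ξ⁻¹·800000·ℓ²(s+t)·(η·L(ηa₁ + 2ta) + 2t)` —
every term carries `t = O(η_j²)` or `η·(ηL∕ξ) = η`.  Road: the pair-box cut-off and its axial gauge `v` ((4d)'s), the cut-off-after-gauging triple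
`(S₀, U₀, A₀)` ((4c)'s) on the pair blocks; exact covariance `Ū(S₀)(c′)Ū(U₀)(c′)⁻¹ = v′·[Ū(𝐔)(c′)Ū(U)(c′)⁻¹]·v′⁻¹` with `v′ = v(emb(y+e_ν))` and
`log(v′Xv′⁻¹) = v′(log X)v′⁻¹`; `Ū(U)(y,ν) = E_ν·v′` with `‖E_ν − 1‖ ≤ 17ℓt` ((4d)); the base change `Ad(v′·axialT U (emb(y+e_ν))) = Ad(H·v)` with
`‖H − 1‖ ≤ (ℓ∕2)t` on the two blocks of `c′` ((4d)'s `H`), costing `3ℓ²ta` inside `Q₁`; and (6c-α) `norm_potRem_translate_sub_potRem_le` for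
`F_{c′}[S₀,U₀,A₀] − F_c[S₀,U₀,A₀]` with the unit-step smoothness `‖A₀(b + Le_ν) − A₀(b)‖ ≤ L(ηa₁ + 2ta)` ((4b)'s sweep).  Letters `linAvg_units_conj`, `scale_zero_shift`, the
pointwise sweep and the base change inside `Q₁` are file `…CombStepRemainderTransportPrelim`.  The re-assembly of the C¹ cancelled sum with this
letter (C1Sum♯♯), the record letters and G⁗′ are NOT here (successor files).  Nothing of Bałaban's analysis is asserted
beyond the cited tree theorems; NE5 NOT printed ∕ NOT proved; N18 NOT discharged; finite tori — nothing about the continuum ∕ OS ∕ mass gap;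
YM mass gap (Clay) NOT proved — R4 closes the conditional finite-𝕋⁴ rung `BalabanLadder.UV` only.

0 `def`, 0 `sorry`.  References: T. Bałaban, CMP **98** (1985) 17–51 [Balaban1985Averaging] (Prop. 3 (122)–(126) p.36, (62)–(63) p.28, (11), (21)–(23) pp.19–21);
CMP **109** (1987) 249–301 [Balaban1987RG1] ((0.4) p.253, (1.10)–(1.13) p.262, (2.17) p.269); Propagators I [Balaban1984PropagatorsI] ((1.11) p.19);
C. King, CMP **102** (1986) 649–677 [King1986] ((3.43)–(3.47) p.661).
-/

noncomputable section

open scoped BigOperators Matrix.Norms.L2Operator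
open NormedSpace

namespace YMDAG.N18.TransportOfRecord

open Complex (I)
open Literature.MathematicalPhysics.QuantumFieldTheory.Balaban1983to89
open Literature.MathematicalPhysics.QuantumFieldTheory.Balaban1983to89.T4Continuum
open Literature.MathematicalPhysics.QuantumFieldTheory.Balaban1983to89.BlockAveraging
open Literature.MathematicalPhysics.QuantumFieldTheory.Balaban1983to89.BlockAveragingEMLLinearised (linAvg combMean linAvg_eq_bondAvg_sub_grad_combMean)
open Literature.MathematicalPhysics.QuantumFieldTheory.Balaban1983to89.LatticeFieldCalculus (bondAvg)
open Literature.MathematicalPhysics.QuantumFieldTheory.Balaban1983to89.B12RegularSpaces111 (expI gaugeU adJ plaq plaq_eq nabla)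
open Literature.MathematicalPhysics.QuantumFieldTheory.Balaban1983to89.B12RegularSpaces111Mono (expI_zero)
open Literature.MathematicalPhysics.QuantumFieldTheory.Balaban1983to89.MatrixLog (mlog)
open Literature.MathematicalPhysics.QuantumFieldTheory.Balaban1983to89.B7Prop1Explicit (l1 U1 mem_U1 treeWord mlog_units_conj)
open Literature.MathematicalPhysics.QuantumFieldTheory.Balaban1983to89.B10Eq27TorusAxialLog (holT rel axialT axialT_self)
open Literature.MathematicalPhysics.QuantumFieldTheory.Balaban1983to89.T4TermwiseBCH (norm_units_conj_le)
open Literature.MathematicalPhysics.QuantumFieldTheory.Balaban1983to89.Node00.W1 (avgUnits)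
open Summit.QuantumFields.YangMills.Theorems.Prop8Chart (emlAvgU_congr₂ norm_emlAvgU_sub_one_sub_linAvg_le)
open Summit.QuantumFields.YangMills.Theorems.Prop7AvgLinearisation (linAvg_sub norm_linAvg_le)
open YMDAG.N18.AvgRemainderUnits (linAvg_congr₂)
open YMDAG.N18.BoxStokes (two_mul_l1_le_of_inBox)

variable {P : Params} {j : ℕ} {n : Type*} [Fintype n] [DecidableEq n] [Nonempty n]

set_option maxHeartbeats 400000 in
/-- ★★★ **THE TRANSPORTED LINEARISATION REMAINDER AT `c′ = c + e_ν` MINUS THE ONE AT `c` IS `O(η_j)`** (raw letters of (4d); `μ = ν` allowed; `j + 2 ≤ m + K`).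
Hypotheses on the pair blocks `{y, y+e_μ, y+e_ν, y+e_μ+e_ν}` as in (4d) `norm_nabla_transported_comb_le` (without `Ū(U)(y,ν) ∈ U1`, not needed), plus `0 < t` and the
smallness `384ℓ((2ηa + t + 2ηa·t) + t) ≤ 1`.
With `Rem₁(d) = (iξ)⁻¹log(Ū(𝐔)(d)Ū(U)(d)⁻¹) − (η∕ξ)·Q₁(Ad(axialT U (emb d₋))A′)(d)`, `R` = the polynomial of (4c), `σ = (2ηa + t + 2ηa·t) + t`:
`‖Ū(U)(y,ν)·Rem₁(c′)·Ū(U)(y,ν)⁻¹ − Rem₁(c)‖ ≤ 4(17ℓt)(R∕ξ + (η∕ξ)·3ℓ²ta) + (η∕ξ)·3ℓ²ta + ξ⁻¹·800000·ℓ²σ·(η·L(ηa₁ + 2ta) + 2t)`.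
[cite: Balaban1985Averaging, Prop. 3 (122)-(126) p.36, (62)-(63) p.28, (11) p.19, (21)-(23) p.21; Balaban1987RG1, (0.4) p.253, (1.10)-(1.13) p.262, (2.17) p.269;
Balaban1984PropagatorsI, (1.11) p.19; King1986, (3.43)-(3.47) p.661] -/
theorem norm_transport_potRem_sub_potRem_le (hj : j + 1 ≤ P.m + P.K) (hj2 : j + 2 ≤ P.m + P.K) (y : Site P (j + 1)) (μ ν : Fin P.d)
    {Uc U : GaugeField P j (Matrix n n ℂ)ˣ} {A : PBond P j → Matrix n n ℂ} {η ξ a a₁ α t : ℝ} (hη : 0 < η) (hξ : 0 < ξ) (ha0 : 0 ≤ a) (ha1 : 0 ≤ a₁)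
    (hα : 0 ≤ α) (ht : 0 < t)
    (hf : ∀ b : PBond P j, (blockOf b.src = y ∨ blockOf b.src = y.shift μ ∨ blockOf b.src = y.shift ν ∨ blockOf b.src = (y.shift μ).shift ν) →
      (blockOf b.tgt = y ∨ blockOf b.tgt = y.shift μ ∨ blockOf b.tgt = y.shift ν ∨ blockOf b.tgt = (y.shift μ).shift ν) → Uc b = expI η (A b) * U b)
    (hA : ∀ b : PBond P j, (blockOf b.src = y ∨ blockOf b.src = y.shift μ ∨ blockOf b.src = y.shift ν ∨ blockOf b.src = (y.shift μ).shift ν) →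
      (blockOf b.tgt = y ∨ blockOf b.tgt = y.shift μ ∨ blockOf b.tgt = y.shift ν ∨ blockOf b.tgt = (y.shift μ).shift ν) → ‖A b‖ ≤ a)
    (hηa : η * a ≤ 1 / 2)
    (hU1 : ∀ b : PBond P j, (blockOf b.src = y ∨ blockOf b.src = y.shift μ ∨ blockOf b.src = y.shift ν ∨ blockOf b.src = (y.shift μ).shift ν) →
      (blockOf b.tgt = y ∨ blockOf b.tgt = y.shift μ ∨ blockOf b.tgt = y.shift ν ∨ blockOf b.tgt = (y.shift μ).shift ν) → U b ∈ U1 (Matrix n n ℂ))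
    (hplaq : ∀ p : Plaq P j, (blockOf p.src = y ∨ blockOf p.src = y.shift μ ∨ blockOf p.src = y.shift ν ∨ blockOf p.src = (y.shift μ).shift ν) →
      (blockOf (p.src.shift p.μ) = y ∨ blockOf (p.src.shift p.μ) = y.shift μ ∨ blockOf (p.src.shift p.μ) = y.shift ν ∨
        blockOf (p.src.shift p.μ) = (y.shift μ).shift ν) →
      (blockOf (p.src.shift p.ν) = y ∨ blockOf (p.src.shift p.ν) = y.shift μ ∨ blockOf (p.src.shift p.ν) = y.shift ν ∨
        blockOf (p.src.shift p.ν) = (y.shift μ).shift ν) →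
      (blockOf ((p.src.shift p.μ).shift p.ν) = y ∨ blockOf ((p.src.shift p.μ).shift p.ν) = y.shift μ ∨
        blockOf ((p.src.shift p.μ).shift p.ν) = y.shift ν ∨ blockOf ((p.src.shift p.μ).shift p.ν) = (y.shift μ).shift ν) →
      ‖((plaq U p : (Matrix n n ℂ)ˣ) : Matrix n n ℂ) - 1‖ ≤ α)
    (hA1 : ∀ (z : Site P j) (κ : Fin P.d),
      (blockOf z = y ∨ blockOf z = y.shift μ ∨ blockOf z = y.shift ν ∨ blockOf z = (y.shift μ).shift ν) →
      (blockOf (z.shift ν) = y ∨ blockOf (z.shift ν) = y.shift μ ∨ blockOf (z.shift ν) = y.shift ν ∨ blockOf (z.shift ν) = (y.shift μ).shift ν) →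
      (blockOf (z.shift κ) = y ∨ blockOf (z.shift κ) = y.shift μ ∨ blockOf (z.shift κ) = y.shift ν ∨ blockOf (z.shift κ) = (y.shift μ).shift ν) →
      (blockOf ((z.shift ν).shift κ) = y ∨ blockOf ((z.shift ν).shift κ) = y.shift μ ∨ blockOf ((z.shift ν).shift κ) = y.shift ν ∨
        blockOf ((z.shift ν).shift κ) = (y.shift μ).shift ν) →
      ‖nabla η U ν (fun w => A ⟨w, κ⟩) z‖ ≤ a₁)
    (hRt : ((((P.d + 4) * P.L : ℕ) : ℝ) / 2) * α ≤ t)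
    (hℓ : 384 * (((P.d + 2) * P.L : ℕ) : ℝ) * ((2 * (η * a) + t + 2 * (η * a) * t) + t) ≤ 1) :
    ‖((avgUnits U ⟨y, ν⟩ : (Matrix n n ℂ)ˣ) : Matrix n n ℂ) *
          ((I * (ξ : ℂ))⁻¹ • mlog (((avgUnits Uc ⟨y.shift ν, μ⟩ : (Matrix n n ℂ)ˣ) : Matrix n n ℂ) * (((avgUnits U ⟨y.shift ν, μ⟩)⁻¹ : (Matrix n n ℂ)ˣ) : Matrix n n ℂ)) -
            ((η / ξ : ℝ) : ℂ) • linAvg (adJ (axialT U (emb (y.shift ν))) A) ⟨y.shift ν, μ⟩) *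
          (((avgUnits U ⟨y, ν⟩)⁻¹ : (Matrix n n ℂ)ˣ) : Matrix n n ℂ) -
        ((I * (ξ : ℂ))⁻¹ • mlog (((avgUnits Uc ⟨y, μ⟩ : (Matrix n n ℂ)ˣ) : Matrix n n ℂ) * (((avgUnits U ⟨y, μ⟩)⁻¹ : (Matrix n n ℂ)ˣ) : Matrix n n ℂ)) -
          ((η / ξ : ℝ) : ℂ) • linAvg (adJ (axialT U (emb y)) A) ⟨y, μ⟩)‖ ≤
      4 * (17 * (((P.d + 2) * P.L : ℕ) : ℝ) * t) *
          ((4 * (34 * (((P.d + 2) * P.L : ℕ) : ℝ) * ((2 * (η * a) + t + 2 * (η * a) * t) + t)) ^ 2 +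
              578 * (((P.d + 2) * P.L : ℕ) : ℝ) ^ 2 * ((2 * (η * a) + t + 2 * (η * a) * t) + t) * t +
              660 * (((P.d + 2) * P.L : ℕ) : ℝ) ^ 2 * ((2 * (η * a) + t + 2 * (η * a) * t) ^ 2 + t ^ 2) +
              3 * (((P.d + 2) * P.L : ℕ) : ℝ) * (2 * (η * a) * t) + 3 * (((P.d + 2) * P.L : ℕ) : ℝ) * (η * a) ^ 2) / ξ +
            η / ξ * (3 * (((P.d + 2) * P.L : ℕ) : ℝ) ^ 2 * t * a)) +
        η / ξ * (3 * (((P.d + 2) * P.L : ℕ) : ℝ) ^ 2 * t * a) +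
        ξ⁻¹ * (800000 * (((P.d + 2) * P.L : ℕ) : ℝ) ^ 2 * ((2 * (η * a) + t + 2 * (η * a) * t) + t) * (η * ((P.L : ℝ) * (η * a₁ + 2 * t * a)) + 2 * t)) := by
  classical
  have ht0 : 0 ≤ t := ht.le
  set ℓ : ℝ := (((P.d + 2) * P.L : ℕ) : ℝ) with hℓdef
  have hℓ0 : 0 ≤ ℓ := Nat.cast_nonneg _
  have hℓ1 : 1 ≤ ℓ := by
    rw [hℓdef]; have := P.L_pos; have : 1 ≤ (P.d + 2) * P.L := Nat.one_le_iff_ne_zero.mpr (by positivity); exact_mod_cast this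
  have hσ0 : 0 ≤ (2 * (η * a) + t + 2 * (η * a) * t) + t := by positivity
  have hℓ136 : 136 * ℓ * ((2 * (η * a) + t + 2 * (η * a) * t) + t) ≤ 1 := by nlinarith only [hℓ, hℓ0, hσ0]
  have hℓt : 136 * ℓ * t ≤ 1 := by
    nlinarith only [hℓ136, hℓ0, ht0, mul_nonneg hη.le ha0, mul_nonneg (mul_nonneg hℓ0 (mul_nonneg hη.le ha0)) ht0]
  have hRt2 : ((((P.d + 2) * P.L : ℕ) : ℝ) / 2) * α ≤ t := by
    refine le_trans (mul_le_mul_of_nonneg_right ?_ hα) hRt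
    gcongr; omega
  have hνμ : (y.shift ν).shift μ = (y.shift μ).shift ν := Site.shift_comm _ _ _
  -- membership maps
  have incC : ∀ x : Site P j, (blockOf x = y ∨ blockOf x = (y.shift μ)) →
      (blockOf x = y ∨ blockOf x = y.shift μ ∨ blockOf x = y.shift ν ∨ blockOf x = (y.shift μ).shift ν) := fun x h => by
    rcases h with h | h
    · exact Or.inl h
    · exact Or.inr (Or.inl h)
  have incC' : ∀ x : Site P j, (blockOf x = (y.shift ν) ∨ blockOf x = ((y.shift ν).shift μ)) →
      (blockOf x = y ∨ blockOf x = y.shift μ ∨ blockOf x = y.shift ν ∨ blockOf x = (y.shift μ).shift ν) := fun x h => by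
    rcases h with h | h
    · exact Or.inr (Or.inr (Or.inl h))
    · refine Or.inr (Or.inr (Or.inr ?_)); rw [← hνμ]; exact h
  have incN : ∀ x : Site P j, (blockOf x = (⟨y, ν⟩ : PBond P (j + 1)).src ∨ blockOf x = (⟨y, ν⟩ : PBond P (j + 1)).tgt) →
      (blockOf x = y ∨ blockOf x = y.shift μ ∨ blockOf x = y.shift ν ∨ blockOf x = (y.shift μ).shift ν) := fun x h => by
    rcases h with h | h
    · exact Or.inl h
    · exact Or.inr (Or.inr (Or.inl h))
  -- the pair-box cut-off (before gauging)
  let χ : PBond P j → Prop := fun b =>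
    (blockOf b.src = y ∨ blockOf b.src = y.shift μ ∨ blockOf b.src = y.shift ν ∨ blockOf b.src = (y.shift μ).shift ν) ∧
    (blockOf b.tgt = y ∨ blockOf b.tgt = y.shift μ ∨ blockOf b.tgt = y.shift ν ∨ blockOf b.tgt = (y.shift μ).shift ν)
  let U' : GaugeField P j (Matrix n n ℂ)ˣ := fun b => if χ b then U b else 1
  let Uc' : GaugeField P j (Matrix n n ℂ)ˣ := fun b => if χ b then Uc b else 1
  let A' : PBond P j → Matrix n n ℂ := fun b => if χ b then A b else 0
  have hU'U : ∀ b : PBond P j, (blockOf b.src = y ∨ blockOf b.src = y.shift μ ∨ blockOf b.src = y.shift ν ∨ blockOf b.src = (y.shift μ).shift ν) →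
      (blockOf b.tgt = y ∨ blockOf b.tgt = y.shift μ ∨ blockOf b.tgt = y.shift ν ∨ blockOf b.tgt = (y.shift μ).shift ν) → U' b = U b :=
    fun b h1 h2 => by simp only [U', χ, if_pos (And.intro h1 h2)]
  have hUc'Uc : ∀ b : PBond P j, (blockOf b.src = y ∨ blockOf b.src = y.shift μ ∨ blockOf b.src = y.shift ν ∨ blockOf b.src = (y.shift μ).shift ν) →
      (blockOf b.tgt = y ∨ blockOf b.tgt = y.shift μ ∨ blockOf b.tgt = y.shift ν ∨ blockOf b.tgt = (y.shift μ).shift ν) → Uc' b = Uc b :=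
    fun b h1 h2 => by simp only [Uc', χ, if_pos (And.intro h1 h2)]
  have hA'A : ∀ b : PBond P j, (blockOf b.src = y ∨ blockOf b.src = y.shift μ ∨ blockOf b.src = y.shift ν ∨ blockOf b.src = (y.shift μ).shift ν) →
      (blockOf b.tgt = y ∨ blockOf b.tgt = y.shift μ ∨ blockOf b.tgt = y.shift ν ∨ blockOf b.tgt = (y.shift μ).shift ν) → A' b = A b :=
    fun b h1 h2 => by simp only [A', χ, if_pos (And.intro h1 h2)]
  have hU'1 : ∀ b, U' b ∈ U1 (Matrix n n ℂ) := fun b => by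
    by_cases hb : χ b
    · simp only [U', if_pos hb]; exact hU1 b hb.1 hb.2
    · simp only [U', if_neg hb]; exact (U1 _).one_mem
  have hf' : ∀ b, Uc' b = expI η (A' b) * U' b := fun b => by
    by_cases hb : χ b
    · simp only [Uc', U', A', if_pos hb]; exact hf b hb.1 hb.2
    · simp only [Uc', U', A', if_neg hb, expI_zero, one_mul]
  have hA'a : ∀ b, ‖A' b‖ ≤ a := fun b => by
    by_cases hb : χ b
    · simp only [A', if_pos hb]; exact hA b hb.1 hb.2
    · simp only [A', if_neg hb, norm_zero]; exact ha0
  have hplaq' : ∀ p : Plaq P j, (blockOf p.src = y ∨ blockOf p.src = y.shift μ ∨ blockOf p.src = y.shift ν ∨ blockOf p.src = (y.shift μ).shift ν) →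
      (blockOf (p.src.shift p.μ) = y ∨ blockOf (p.src.shift p.μ) = y.shift μ ∨ blockOf (p.src.shift p.μ) = y.shift ν ∨
        blockOf (p.src.shift p.μ) = (y.shift μ).shift ν) →
      (blockOf (p.src.shift p.ν) = y ∨ blockOf (p.src.shift p.ν) = y.shift μ ∨ blockOf (p.src.shift p.ν) = y.shift ν ∨
        blockOf (p.src.shift p.ν) = (y.shift μ).shift ν) →
      (blockOf ((p.src.shift p.μ).shift p.ν) = y ∨ blockOf ((p.src.shift p.μ).shift p.ν) = y.shift μ ∨
        blockOf ((p.src.shift p.μ).shift p.ν) = y.shift ν ∨ blockOf ((p.src.shift p.μ).shift p.ν) = (y.shift μ).shift ν) →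
      ‖((plaq U' p : (Matrix n n ℂ)ˣ) : Matrix n n ℂ) - 1‖ ≤ α := fun p c1 c2 c3 c4 => by
    have hpe : plaq U' p = plaq U p := by
      rw [plaq_eq, plaq_eq, hU'U ⟨p.src, p.μ⟩ c1 c2, hU'U ⟨p.src.shift p.μ, p.ν⟩ c2 c4, hU'U ⟨p.src, p.ν⟩ c1 c3,
        hU'U ⟨p.src.shift p.ν, p.μ⟩ c3 (by rw [PBond.tgt, Site.shift_comm]; exact c4)]
    rw [hpe]; exact hplaq p c1 c2 c3 c4
  -- the pair-box axial gauge `v` (globally `U1`, `= 1` at `emb y`, `= axialT U (emb y)` on the pair blocks)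
  set v : Site P j → (Matrix n n ℂ)ˣ := axialT U' (emb y) with hvdef
  have hv1 : ∀ x, v x ∈ U1 (Matrix n n ℂ) := fun x => axialT_mem_U1 hU'1 _ x
  have hv0 : v (emb y) = 1 := axialT_self U' (emb y)
  have hvU : ∀ x : Site P j, (blockOf x = y ∨ blockOf x = y.shift μ ∨ blockOf x = y.shift ν ∨ blockOf x = (y.shift μ).shift ν) →
      v x = axialT U (emb y) x := fun x hx => axialT_congr_of_pairBlocks hj hj2 y μ ν hU'U hx
  -- cut off AFTER gauging: the factorised small triple on ALL bonds
  let U₀ : GaugeField P j (Matrix n n ℂ)ˣ := fun b => if χ b then gaugeU v U' b else 1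
  let S₀ : GaugeField P j (Matrix n n ℂ)ˣ := fun b => if χ b then gaugeU v Uc' b else 1
  let A₀ : PBond P j → Matrix n n ℂ := fun b => if χ b then adJ v A' b else 0
  have hS : ∀ b, S₀ b = expI η (A₀ b) * U₀ b := fun b => by
    by_cases hb : χ b
    · simp only [S₀, U₀, A₀, if_pos hb]; exact gaugeU_factors hf' v b
    · simp only [S₀, U₀, A₀, if_neg hb, expI_zero, one_mul]
  have hA₀ : ∀ b, ‖A₀ b‖ ≤ a := fun b => by
    by_cases hb : χ b
    · simp only [A₀, if_pos hb]; exact norm_adJ_le_of_U1 hv1 hA'a b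
    · simp only [A₀, if_neg hb, norm_zero]; exact ha0
  have hU₀ : ∀ b, ‖((U₀ b : (Matrix n n ℂ)ˣ) : Matrix n n ℂ) - 1‖ ≤ t := fun b => by
    by_cases hb : χ b
    · simp only [U₀, if_pos hb]
      exact (norm_gaugeU_axialT_sub_one_le_of_pairBlocks hj hj2 hU'1 y μ ν hα hplaq' b hb.1 hb.2).trans hRt
    · simp only [U₀, if_neg hb, Units.val_one, sub_self, norm_zero]; exact ht0
  have hA₀eq : ∀ b : PBond P j, (blockOf b.src = y ∨ blockOf b.src = y.shift μ ∨ blockOf b.src = y.shift ν ∨ blockOf b.src = (y.shift μ).shift ν) →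
      (blockOf b.tgt = y ∨ blockOf b.tgt = y.shift μ ∨ blockOf b.tgt = y.shift ν ∨ blockOf b.tgt = (y.shift μ).shift ν) →
      A₀ b = adJ (axialT U (emb y)) A b := fun b h1 h2 => by
    simp only [A₀, χ, if_pos (And.intro h1 h2), adJ, hA'A b h1 h2, hvU b.src h1]
  -- (I) the quotient of the averages at `c`: gauge `v` is `1` at `emb y`
  have hquot : ((avgUnits S₀ ⟨y, μ⟩ : (Matrix n n ℂ)ˣ) : Matrix n n ℂ) * (((avgUnits U₀ ⟨y, μ⟩)⁻¹ : (Matrix n n ℂ)ˣ) : Matrix n n ℂ) =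
      ((avgUnits Uc ⟨y, μ⟩ : (Matrix n n ℂ)ˣ) : Matrix n n ℂ) * (((avgUnits U ⟨y, μ⟩)⁻¹ : (Matrix n n ℂ)ˣ) : Matrix n n ℂ) := by
    have hS₀loc : avgUnits S₀ ⟨y, μ⟩ = avgUnits (gaugeU v Uc') ⟨y, μ⟩ :=
      (emlAvgU_congr₂ hj ⟨y, μ⟩ fun b h1 h2 => by simp only [S₀, χ, if_pos (And.intro (incC _ h1) (incC _ h2))]).symm
    have hU₀loc : avgUnits U₀ ⟨y, μ⟩ = avgUnits (gaugeU v U') ⟨y, μ⟩ :=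
      (emlAvgU_congr₂ hj ⟨y, μ⟩ fun b h1 h2 => by simp only [U₀, χ, if_pos (And.intro (incC _ h1) (incC _ h2))]).symm
    have hUc'loc : avgUnits Uc' ⟨y, μ⟩ = avgUnits Uc ⟨y, μ⟩ := (emlAvgU_congr₂ hj ⟨y, μ⟩ fun b h1 h2 => (hUc'Uc b (incC _ h1) (incC _ h2)).symm).symm
    have hU'loc : avgUnits U' ⟨y, μ⟩ = avgUnits U ⟨y, μ⟩ := (emlAvgU_congr₂ hj ⟨y, μ⟩ fun b h1 h2 => (hU'U b (incC _ h1) (incC _ h2)).symm).symm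
    rw [hS₀loc, hU₀loc, ← Units.val_mul, avgUnits_mul_inv_gaugeU]
    show (((v (emb y)) * (avgUnits Uc' ⟨y, μ⟩ * (avgUnits U' ⟨y, μ⟩)⁻¹) * (v (emb y))⁻¹ : (Matrix n n ℂ)ˣ) : Matrix n n ℂ) = _
    rw [hv0, one_mul, inv_one, mul_one, Units.val_mul, hUc'loc, hU'loc]
  have hQc : linAvg (adJ (axialT U (emb y)) A) ⟨y, μ⟩ = linAvg A₀ ⟨y, μ⟩ :=
    (linAvg_congr₂ hj ⟨y, μ⟩ fun b h1 h2 => hA₀eq b (incC _ h1) (incC _ h2)).symm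
  -- (II) the quotient at `c′`: conjugated by `v′ = v(emb(y+e_ν))`
  have hctr' : blockOf (emb (y.shift ν)) = y.shift ν := Site.blockOf_emb hj _
  set v' : (Matrix n n ℂ)ˣ := v (emb (y.shift ν)) with hv'def
  have hv'1 : v' ∈ U1 (Matrix n n ℂ) := hv1 _
  have hv'eq : v' = axialT U (emb y) (emb (y.shift ν)) := hvU _ (Or.inr (Or.inr (Or.inl hctr')))
  have hquot' : ((avgUnits S₀ ⟨y.shift ν, μ⟩ : (Matrix n n ℂ)ˣ) : Matrix n n ℂ) * (((avgUnits U₀ ⟨y.shift ν, μ⟩)⁻¹ : (Matrix n n ℂ)ˣ) : Matrix n n ℂ) =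
      (v' : Matrix n n ℂ) * (((avgUnits Uc ⟨y.shift ν, μ⟩ : (Matrix n n ℂ)ˣ) : Matrix n n ℂ) * (((avgUnits U ⟨y.shift ν, μ⟩)⁻¹ : (Matrix n n ℂ)ˣ) : Matrix n n ℂ)) *
        ((v'⁻¹ : (Matrix n n ℂ)ˣ) : Matrix n n ℂ) := by
    have hS₀loc : avgUnits S₀ ⟨y.shift ν, μ⟩ = avgUnits (gaugeU v Uc') ⟨y.shift ν, μ⟩ :=
      (emlAvgU_congr₂ hj ⟨y.shift ν, μ⟩ fun b h1 h2 => by simp only [S₀, χ, if_pos (And.intro (incC' _ h1) (incC' _ h2))]).symm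
    have hU₀loc : avgUnits U₀ ⟨y.shift ν, μ⟩ = avgUnits (gaugeU v U') ⟨y.shift ν, μ⟩ :=
      (emlAvgU_congr₂ hj ⟨y.shift ν, μ⟩ fun b h1 h2 => by simp only [U₀, χ, if_pos (And.intro (incC' _ h1) (incC' _ h2))]).symm
    have hUc'loc : avgUnits Uc' ⟨y.shift ν, μ⟩ = avgUnits Uc ⟨y.shift ν, μ⟩ :=
      (emlAvgU_congr₂ hj ⟨y.shift ν, μ⟩ fun b h1 h2 => (hUc'Uc b (incC' _ h1) (incC' _ h2)).symm).symm
    have hU'loc : avgUnits U' ⟨y.shift ν, μ⟩ = avgUnits U ⟨y.shift ν, μ⟩ :=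
      (emlAvgU_congr₂ hj ⟨y.shift ν, μ⟩ fun b h1 h2 => (hU'U b (incC' _ h1) (incC' _ h2)).symm).symm
    rw [hS₀loc, hU₀loc, ← Units.val_mul, avgUnits_mul_inv_gaugeU]
    show (((v (emb (y.shift ν))) * (avgUnits Uc' ⟨y.shift ν, μ⟩ * (avgUnits U' ⟨y.shift ν, μ⟩)⁻¹) * (v (emb (y.shift ν)))⁻¹ : (Matrix n n ℂ)ˣ) : Matrix n n ℂ) = _
    rw [hUc'loc, hU'loc, Units.val_mul, Units.val_mul, Units.val_mul]
  -- sizes of the gauged quotient at `c′` (global Prop. 3) and the logarithm is covariant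
  have hSb : ∀ b, ‖((S₀ b : (Matrix n n ℂ)ˣ) : Matrix n n ℂ) - 1‖ ≤ 2 * (η * a) + t + 2 * (η * a) * t := fun b => by
    rw [hS b, Units.val_mul]
    have he : ‖((expI η (A₀ b) : (Matrix n n ℂ)ˣ) : Matrix n n ℂ) - 1‖ ≤ 2 * (η * a) :=
      (norm_coe_expI_sub_one_le hη.le ((mul_le_mul_of_nonneg_left (hA₀ b) hη.le).trans (by linarith))).trans (by nlinarith [hA₀ b, hη.le])
    have hid : ((expI η (A₀ b) : (Matrix n n ℂ)ˣ) : Matrix n n ℂ) * ((U₀ b : (Matrix n n ℂ)ˣ) : Matrix n n ℂ) - 1 =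
        (((expI η (A₀ b) : (Matrix n n ℂ)ˣ) : Matrix n n ℂ) - 1) * (((U₀ b : (Matrix n n ℂ)ˣ) : Matrix n n ℂ) - 1) +
          ((((expI η (A₀ b) : (Matrix n n ℂ)ˣ) : Matrix n n ℂ) - 1) + (((U₀ b : (Matrix n n ℂ)ˣ) : Matrix n n ℂ) - 1)) := by noncomm_ring
    rw [hid]
    calc _ ≤ ‖(((expI η (A₀ b) : (Matrix n n ℂ)ˣ) : Matrix n n ℂ) - 1) * (((U₀ b : (Matrix n n ℂ)ˣ) : Matrix n n ℂ) - 1)‖ +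
          ‖(((expI η (A₀ b) : (Matrix n n ℂ)ˣ) : Matrix n n ℂ) - 1) + (((U₀ b : (Matrix n n ℂ)ˣ) : Matrix n n ℂ) - 1)‖ := norm_add_le _ _
      _ ≤ 2 * (η * a) * t + (2 * (η * a) + t) :=
          add_le_add ((norm_mul_le _ _).trans (mul_le_mul he (hU₀ b) (norm_nonneg _) (by positivity))) ((norm_add_le _ _).trans (add_le_add he (hU₀ b)))
      _ = 2 * (η * a) + t + 2 * (η * a) * t := by ring
  have hs0 : 0 ≤ 2 * (η * a) + t + 2 * (η * a) * t := by positivity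
  have h48s : 48 * ℓ * (2 * (η * a) + t + 2 * (η * a) * t) ≤ 1 := by nlinarith only [hℓ136, hℓ0, ht0, hs0]
  have h48t : 48 * ℓ * t ≤ 1 := by nlinarith only [hℓ136, hℓ0, ht0, hs0]
  obtain ⟨-, hX2'⟩ := norm_emlAvgU_sub_one_sub_linAvg_le hj (S := S₀) ⟨y.shift ν, μ⟩ hs0 h48s (fun b _ _ => hSb b)
  obtain ⟨-, hY2'⟩ := norm_emlAvgU_sub_one_sub_linAvg_le hj (S := U₀) ⟨y.shift ν, μ⟩ ht0 h48t (fun b _ _ => hU₀ b)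
  have hW'1 : ‖((avgUnits S₀ ⟨y.shift ν, μ⟩ : (Matrix n n ℂ)ˣ) : Matrix n n ℂ) * (((avgUnits U₀ ⟨y.shift ν, μ⟩)⁻¹ : (Matrix n n ℂ)ˣ) : Matrix n n ℂ) - 1‖ < 1 := by
    change ‖((avgUnits S₀ ⟨y.shift ν, μ⟩ : (Matrix n n ℂ)ˣ) : Matrix n n ℂ) - 1‖ ≤ 17 * ℓ * (2 * (η * a) + t + 2 * (η * a) * t) at hX2'
    change ‖((avgUnits U₀ ⟨y.shift ν, μ⟩ : (Matrix n n ℂ)ˣ) : Matrix n n ℂ) - 1‖ ≤ 17 * ℓ * t at hY2'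
    have hq : 17 * ℓ * t ≤ 1 / 2 := by nlinarith only [hℓt, hℓ0, ht0]
    obtain ⟨hBi1, -⟩ := norm_units_inv_le_of_norm_sub_one_le (u := avgUnits U₀ ⟨y.shift ν, μ⟩) hY2' hq
    have hBB : ((avgUnits U₀ ⟨y.shift ν, μ⟩ : (Matrix n n ℂ)ˣ) : Matrix n n ℂ) * (((avgUnits U₀ ⟨y.shift ν, μ⟩)⁻¹ : (Matrix n n ℂ)ˣ) : Matrix n n ℂ) = 1 :=
      Units.mul_inv _
    have hAB : ‖((avgUnits S₀ ⟨y.shift ν, μ⟩ : (Matrix n n ℂ)ˣ) : Matrix n n ℂ) - ((avgUnits U₀ ⟨y.shift ν, μ⟩ : (Matrix n n ℂ)ˣ) : Matrix n n ℂ)‖ ≤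
        17 * ℓ * (2 * (η * a) + t + 2 * (η * a) * t) + 17 * ℓ * t := by
      have : ((avgUnits S₀ ⟨y.shift ν, μ⟩ : (Matrix n n ℂ)ˣ) : Matrix n n ℂ) - ((avgUnits U₀ ⟨y.shift ν, μ⟩ : (Matrix n n ℂ)ˣ) : Matrix n n ℂ) =
          (((avgUnits S₀ ⟨y.shift ν, μ⟩ : (Matrix n n ℂ)ˣ) : Matrix n n ℂ) - 1) - (((avgUnits U₀ ⟨y.shift ν, μ⟩ : (Matrix n n ℂ)ˣ) : Matrix n n ℂ) - 1) := by abel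
      rw [this]; exact (norm_sub_le _ _).trans (add_le_add hX2' hY2')
    have hid : ((avgUnits S₀ ⟨y.shift ν, μ⟩ : (Matrix n n ℂ)ˣ) : Matrix n n ℂ) * (((avgUnits U₀ ⟨y.shift ν, μ⟩)⁻¹ : (Matrix n n ℂ)ˣ) : Matrix n n ℂ) - 1 =
        (((avgUnits S₀ ⟨y.shift ν, μ⟩ : (Matrix n n ℂ)ˣ) : Matrix n n ℂ) - ((avgUnits U₀ ⟨y.shift ν, μ⟩ : (Matrix n n ℂ)ˣ) : Matrix n n ℂ)) *
          (((avgUnits U₀ ⟨y.shift ν, μ⟩)⁻¹ : (Matrix n n ℂ)ˣ) : Matrix n n ℂ) := by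
      rw [sub_mul, hBB]
    rw [hid]
    refine lt_of_le_of_lt ((norm_mul_le _ _).trans (mul_le_mul hAB hBi1 (norm_nonneg _) (by positivity))) ?_
    nlinarith only [hℓ136, hℓ0, ht0, hs0]
  have hmlog' : (v' : Matrix n n ℂ) * mlog (((avgUnits Uc ⟨y.shift ν, μ⟩ : (Matrix n n ℂ)ˣ) : Matrix n n ℂ) * (((avgUnits U ⟨y.shift ν, μ⟩)⁻¹ : (Matrix n n ℂ)ˣ) : Matrix n n ℂ)) * ((v'⁻¹ : (Matrix n n ℂ)ˣ) : Matrix n n ℂ) = mlog (((avgUnits S₀ ⟨y.shift ν, μ⟩ : (Matrix n n ℂ)ˣ) : Matrix n n ℂ) * (((avgUnits U₀ ⟨y.shift ν, μ⟩)⁻¹ : (Matrix n n ℂ)ˣ) : Matrix n n ℂ)) := by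
    have hXW : ((avgUnits Uc ⟨y.shift ν, μ⟩ : (Matrix n n ℂ)ˣ) : Matrix n n ℂ) * (((avgUnits U ⟨y.shift ν, μ⟩)⁻¹ : (Matrix n n ℂ)ˣ) : Matrix n n ℂ) = (((v'⁻¹ : (Matrix n n ℂ)ˣ)) : Matrix n n ℂ) * (((avgUnits S₀ ⟨y.shift ν, μ⟩ : (Matrix n n ℂ)ˣ) : Matrix n n ℂ) * (((avgUnits U₀ ⟨y.shift ν, μ⟩)⁻¹ : (Matrix n n ℂ)ˣ) : Matrix n n ℂ)) * ((((v'⁻¹)⁻¹ : (Matrix n n ℂ)ˣ)) : Matrix n n ℂ) := by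
      rw [hquot', inv_inv]; simp only [← mul_assoc, Units.inv_mul, one_mul]; rw [mul_assoc, Units.inv_mul, mul_one]
    rw [hXW, mlog_units_conj ((U1 _).inv_mem hv'1) hW'1, inv_inv]
    simp only [← mul_assoc, Units.mul_inv, one_mul]; rw [mul_assoc, Units.mul_inv, mul_one]
  -- (III) the base change inside `Q₁` at `c′` (Prelim ★ `norm_conj_linAvg_adJ_shift_sub_le`), in `A₀`-letters
  have hΔ : ‖(v' : Matrix n n ℂ) * linAvg (adJ (axialT U (emb (y.shift ν))) A) ⟨y.shift ν, μ⟩ * ((v'⁻¹ : (Matrix n n ℂ)ˣ) : Matrix n n ℂ) -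
      linAvg A₀ ⟨y.shift ν, μ⟩‖ ≤ 3 * ℓ * (ℓ * t * a) := by
    have h := norm_conj_linAvg_adJ_shift_sub_le hj hj2 y μ ν ha0 hα hU1 hplaq hA hRt
    have hQc' : linAvg (adJ (axialT U (emb y)) A) ⟨y.shift ν, μ⟩ = linAvg A₀ ⟨y.shift ν, μ⟩ :=
      (linAvg_congr₂ hj ⟨y.shift ν, μ⟩ fun b h1 h2 => hA₀eq b (incC' _ h1) (incC' _ h2)).symm
    rw [hQc', ← hv'eq, ← hℓdef] at h
    exact h
  -- `U^v` within `t` on the pair-block bonds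
  have hV₀ : ∀ b : PBond P j, (blockOf b.src = y ∨ blockOf b.src = y.shift μ ∨ blockOf b.src = y.shift ν ∨ blockOf b.src = (y.shift μ).shift ν) →
      (blockOf b.tgt = y ∨ blockOf b.tgt = y.shift μ ∨ blockOf b.tgt = y.shift ν ∨ blockOf b.tgt = (y.shift μ).shift ν) →
      ‖((gaugeU (axialT U (emb y)) U b : (Matrix n n ℂ)ˣ) : Matrix n n ℂ) - 1‖ ≤ t := fun b h1 h2 => by
    have heq : gaugeU (axialT U (emb y)) U b = gaugeU v U' b := by
      simp only [gaugeU, hvU b.src h1, hvU b.tgt h2, hU'U b h1 h2]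
    rw [heq]; exact (norm_gaugeU_axialT_sub_one_le_of_pairBlocks hj hj2 hU'1 y μ ν hα hplaq' b h1 h2).trans hRt
  -- (IV) `Ū(U)(y,ν) = E_ν·v′`, `‖E_ν − 1‖ ≤ 17ℓt` ((4d)'s factorisation)
  let Uν : GaugeField P j (Matrix n n ℂ)ˣ := fun b =>
    if (blockOf b.src = y ∨ blockOf b.src = y.shift ν) ∧ (blockOf b.tgt = y ∨ blockOf b.tgt = y.shift ν) then U b else 1
  have hUνU : ∀ b : PBond P j, (blockOf b.src = (⟨y, ν⟩ : PBond P (j + 1)).src ∨ blockOf b.src = (⟨y, ν⟩ : PBond P (j + 1)).tgt) →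
      (blockOf b.tgt = (⟨y, ν⟩ : PBond P (j + 1)).src ∨ blockOf b.tgt = (⟨y, ν⟩ : PBond P (j + 1)).tgt) → Uν b = U b := fun b h1 h2 => by
    have hb : (blockOf b.src = y ∨ blockOf b.src = y.shift ν) ∧ (blockOf b.tgt = y ∨ blockOf b.tgt = y.shift ν) := ⟨h1, h2⟩
    simp only [Uν, if_pos hb]
  have hUν1 : ∀ b, Uν b ∈ U1 (Matrix n n ℂ) := fun b => by
    by_cases hb : (blockOf b.src = y ∨ blockOf b.src = y.shift ν) ∧ (blockOf b.tgt = y ∨ blockOf b.tgt = y.shift ν)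
    · simp only [Uν, if_pos hb]; exact hU1 b (incN _ hb.1) (incN _ hb.2)
    · simp only [Uν, if_neg hb]; exact (U1 _).one_mem
  have hvν : ∀ x : Site P j, (blockOf x = (⟨y, ν⟩ : PBond P (j + 1)).src ∨ blockOf x = (⟨y, ν⟩ : PBond P (j + 1)).tgt) →
      (axialT U (emb y)) x = axialT Uν (emb y) x := fun x hx => (axialT_congr_of_twoBlock hj hj2 ⟨y, ν⟩ hUνU hx).symm
  have hVν : ∀ b : PBond P j, (blockOf b.src = (⟨y, ν⟩ : PBond P (j + 1)).src ∨ blockOf b.src = (⟨y, ν⟩ : PBond P (j + 1)).tgt) →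
      (blockOf b.tgt = (⟨y, ν⟩ : PBond P (j + 1)).src ∨ blockOf b.tgt = (⟨y, ν⟩ : PBond P (j + 1)).tgt) →
      ‖((gaugeU (axialT Uν (emb y)) Uν b : (Matrix n n ℂ)ˣ) : Matrix n n ℂ) - 1‖ ≤ t := fun b h1 h2 => by
    have heq : gaugeU (axialT Uν (emb y)) Uν b = gaugeU (axialT U (emb y)) U b := by
      simp only [gaugeU, hvν b.src h1, hvν b.tgt h2, hUνU b h1 h2]
    rw [heq]; exact hV₀ b (incN _ h1) (incN _ h2)
  have h17 := (norm_emlAvgU_sub_one_sub_linAvg_le hj (S := gaugeU (axialT Uν (emb y)) Uν) ⟨y, ν⟩ ht0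
    (by nlinarith only [hℓt, mul_nonneg hℓ0 ht0]) hVν).2
  set Eν : (Matrix n n ℂ)ˣ := avgUnits (gaugeU (axialT Uν (emb y)) Uν) ⟨y, ν⟩ with hEν
  change ‖(Eν : Matrix n n ℂ) - 1‖ ≤ 17 * ℓ * t at h17
  have hUAν_eq : avgUnits U ⟨y, ν⟩ = Eν * v' := by
    have hcov := avgUnits_gaugeU (axialT Uν (emb y)) Uν
    have hloc : avgUnits Uν ⟨y, ν⟩ = avgUnits U ⟨y, ν⟩ := emlAvgU_congr₂ hj ⟨y, ν⟩ hUνU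
    have hE' : Eν = axialT Uν (emb y) (emb y) * avgUnits U ⟨y, ν⟩ * (axialT Uν (emb y) (emb (y.shift ν)))⁻¹ := by
      rw [hEν, hcov]; simp only [gaugeU, hloc]; rfl
    rw [hE', axialT_self, one_mul, hv'eq, hvν _ (Or.inr hctr'), inv_mul_cancel_right]
  -- (V) the size of `F′ = F_{c′}[S₀,U₀,A₀]` and the shift `F′ − F` ((6c-α) with the unit-step smoothness of `A₀`)
  have hF' := norm_potential_sub_linAvg_le hj hη.le hξ hS ha0 hA₀ hηa ht0 hU₀ hℓ136 ⟨y.shift ν, μ⟩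
  have hdA : ∀ b : PBond P j, (blockOf b.src = (⟨y, μ⟩ : PBond P (j + 1)).src ∨ blockOf b.src = (⟨y, μ⟩ : PBond P (j + 1)).tgt) →
      (blockOf b.tgt = (⟨y, μ⟩ : PBond P (j + 1)).src ∨ blockOf b.tgt = (⟨y, μ⟩ : PBond P (j + 1)).tgt) →
      ‖A₀ (b.translate (Site.scale ((0 : Site P (j + 1)).shift ν))) - A₀ b‖ ≤ (P.L : ℝ) * (η * a₁ + 2 * t * a) := fun b h1 h2 => by
    rw [scale_zero_shift]
    -- both ends of the sweep are pair-block bonds, where `A₀ = Ad(axialT U (emb y))A`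
    have hsrcL := blockOf_add_nsmul_shift_mem_pairBlocks hj hj2 y μ ν (x := b.src) h1 le_rfl
    have htgtL : blockOf (b.translate (P.L • (0 : Site P j).shift ν)).tgt = y ∨ blockOf (b.translate (P.L • (0 : Site P j).shift ν)).tgt = y.shift μ ∨
        blockOf (b.translate (P.L • (0 : Site P j).shift ν)).tgt = y.shift ν ∨ blockOf (b.translate (P.L • (0 : Site P j).shift ν)).tgt = (y.shift μ).shift ν := by
      have h := blockOf_add_nsmul_shift_mem_pairBlocks hj hj2 y μ ν (x := b.tgt) h2 (le_refl P.L)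
      have heq : b.tgt + P.L • (0 : Site P j).shift ν = (b.translate (P.L • (0 : Site P j).shift ν)).tgt := by
        rw [PBond.tgt, PBond.tgt, PBond.translate_src, PBond.translate_dir, ← Site.add_zero_shift b.src b.dir,
          ← Site.add_zero_shift (b.src + P.L • (0 : Site P j).shift ν) b.dir]
        abel
      rwa [heq] at h
    rw [hA₀eq _ hsrcL htgtL, hA₀eq b (incC _ h1) (incC _ h2)]
    exact norm_adJ_axialT_translate_sub_le hj hj2 y μ ν hη hα hU1 hplaq hA hA1 hRt b h1 h2
  have hshift := norm_potRem_translate_sub_potRem_le hj ((0 : Site P (j + 1)).shift ν) hη.le hξ hS hA₀ hηa ht hU₀ (by positivity) ⟨y, μ⟩ hdA hℓ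
  rw [translate_zero_shift_eq] at hshift
  -- (VI) assemble
  set F' : Matrix n n ℂ := (I * (ξ : ℂ))⁻¹ • mlog (((avgUnits S₀ ⟨y.shift ν, μ⟩ : (Matrix n n ℂ)ˣ) : Matrix n n ℂ) * (((avgUnits U₀ ⟨y.shift ν, μ⟩)⁻¹ : (Matrix n n ℂ)ˣ) : Matrix n n ℂ)) - ((η / ξ : ℝ) : ℂ) • linAvg A₀ ⟨y.shift ν, μ⟩ with hF'def
  set F : Matrix n n ℂ := (I * (ξ : ℂ))⁻¹ • mlog (((avgUnits S₀ ⟨y, μ⟩ : (Matrix n n ℂ)ˣ) : Matrix n n ℂ) * (((avgUnits U₀ ⟨y, μ⟩)⁻¹ : (Matrix n n ℂ)ˣ) : Matrix n n ℂ)) -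
    ((η / ξ : ℝ) : ℂ) • linAvg A₀ ⟨y, μ⟩ with hFdef
  change ‖F'‖ ≤ _ at hF'
  change ‖F' - F‖ ≤ _ at hshift
  set Δ : Matrix n n ℂ := (v' : Matrix n n ℂ) * linAvg (adJ (axialT U (emb (y.shift ν))) A) ⟨y.shift ν, μ⟩ * ((v'⁻¹ : (Matrix n n ℂ)ˣ) : Matrix n n ℂ) -
      linAvg A₀ ⟨y.shift ν, μ⟩ with hΔdef
  -- the conjugated remainder at `c′`
  have hconj : ((avgUnits U ⟨y, ν⟩ : (Matrix n n ℂ)ˣ) : Matrix n n ℂ) *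
        ((I * (ξ : ℂ))⁻¹ • mlog (((avgUnits Uc ⟨y.shift ν, μ⟩ : (Matrix n n ℂ)ˣ) : Matrix n n ℂ) * (((avgUnits U ⟨y.shift ν, μ⟩)⁻¹ : (Matrix n n ℂ)ˣ) : Matrix n n ℂ)) - ((η / ξ : ℝ) : ℂ) • linAvg (adJ (axialT U (emb (y.shift ν))) A) ⟨y.shift ν, μ⟩) *
        (((avgUnits U ⟨y, ν⟩)⁻¹ : (Matrix n n ℂ)ˣ) : Matrix n n ℂ) =
      (Eν : Matrix n n ℂ) * (F' - ((η / ξ : ℝ) : ℂ) • Δ) * ((Eν⁻¹ : (Matrix n n ℂ)ˣ) : Matrix n n ℂ) := by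
    have hinner : (v' : Matrix n n ℂ) * ((I * (ξ : ℂ))⁻¹ • mlog (((avgUnits Uc ⟨y.shift ν, μ⟩ : (Matrix n n ℂ)ˣ) : Matrix n n ℂ) * (((avgUnits U ⟨y.shift ν, μ⟩)⁻¹ : (Matrix n n ℂ)ˣ) : Matrix n n ℂ)) - ((η / ξ : ℝ) : ℂ) • linAvg (adJ (axialT U (emb (y.shift ν))) A) ⟨y.shift ν, μ⟩) *
        ((v'⁻¹ : (Matrix n n ℂ)ˣ) : Matrix n n ℂ) = F' - ((η / ξ : ℝ) : ℂ) • Δ := by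
      rw [hF'def, hΔdef, ← hmlog']
      simp only [mul_sub, sub_mul, mul_smul_comm, smul_mul_assoc, smul_sub]
      abel
    rw [hUAν_eq, mul_inv_rev Eν v', Units.val_mul, Units.val_mul, ← hinner]
    noncomm_ring
  have hc0 : (I * (ξ : ℂ))⁻¹ • mlog (((avgUnits Uc ⟨y, μ⟩ : (Matrix n n ℂ)ˣ) : Matrix n n ℂ) * (((avgUnits U ⟨y, μ⟩)⁻¹ : (Matrix n n ℂ)ˣ) : Matrix n n ℂ)) -
      ((η / ξ : ℝ) : ℂ) • linAvg (adJ (axialT U (emb y)) A) ⟨y, μ⟩ = F := by rw [hFdef, hquot, hQc]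
  rw [hconj, hc0]
  have hsplit : (Eν : Matrix n n ℂ) * (F' - ((η / ξ : ℝ) : ℂ) • Δ) * ((Eν⁻¹ : (Matrix n n ℂ)ˣ) : Matrix n n ℂ) - F =
      ((Eν : Matrix n n ℂ) * (F' - ((η / ξ : ℝ) : ℂ) • Δ) * ((Eν⁻¹ : (Matrix n n ℂ)ˣ) : Matrix n n ℂ) - (F' - ((η / ξ : ℝ) : ℂ) • Δ)) +
        (-(((η / ξ : ℝ) : ℂ) • Δ)) + (F' - F) := by abel
  rw [hsplit]
  have hηξ : 0 ≤ η / ξ := div_nonneg hη.le hξ.le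
  have hΔn : ‖((η / ξ : ℝ) : ℂ) • Δ‖ ≤ η / ξ * (3 * ℓ ^ 2 * t * a) := by
    rw [norm_smul, Complex.norm_real, Real.norm_of_nonneg hηξ]
    exact mul_le_mul_of_nonneg_left (hΔ.trans (le_of_eq (by ring))) hηξ
  have hFΔ : ‖F' - ((η / ξ : ℝ) : ℂ) • Δ‖ ≤
      (4 * (34 * ℓ * ((2 * (η * a) + t + 2 * (η * a) * t) + t)) ^ 2 + 578 * ℓ ^ 2 * ((2 * (η * a) + t + 2 * (η * a) * t) + t) * t +
          660 * ℓ ^ 2 * ((2 * (η * a) + t + 2 * (η * a) * t) ^ 2 + t ^ 2) + 3 * ℓ * (2 * (η * a) * t) + 3 * ℓ * (η * a) ^ 2) / ξ +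
        η / ξ * (3 * ℓ ^ 2 * t * a) := (norm_sub_le _ _).trans (add_le_add hF' hΔn)
  have h1 := norm_conj_sub_le_of_near_one h17 (by nlinarith only [hℓt, mul_nonneg hℓ0 ht0]) (F' - ((η / ξ : ℝ) : ℂ) • Δ)
  refine (norm_add₃_le).trans ?_
  rw [norm_neg]
  have h1' : ‖(Eν : Matrix n n ℂ) * (F' - ((η / ξ : ℝ) : ℂ) • Δ) * ((Eν⁻¹ : (Matrix n n ℂ)ˣ) : Matrix n n ℂ) - (F' - ((η / ξ : ℝ) : ℂ) • Δ)‖ ≤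
      4 * (17 * ℓ * t) * ((4 * (34 * ℓ * ((2 * (η * a) + t + 2 * (η * a) * t) + t)) ^ 2 + 578 * ℓ ^ 2 * ((2 * (η * a) + t + 2 * (η * a) * t) + t) * t +
          660 * ℓ ^ 2 * ((2 * (η * a) + t + 2 * (η * a) * t) ^ 2 + t ^ 2) + 3 * ℓ * (2 * (η * a) * t) + 3 * ℓ * (η * a) ^ 2) / ξ +
        η / ξ * (3 * ℓ ^ 2 * t * a)) :=
    h1.trans (mul_le_mul_of_nonneg_left hFΔ (by positivity))
  rw [hℓdef] at h1' hΔn ⊢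
  linarith [h1', hΔn, hshift]

end YMDAG.N18.TransportOfRecord

end
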